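import Summits.Ventures.PercRepro2.CaseOneStarPin

/-!
# The marked star: the status cells of the base
(blind cell PercRepro2, p1 g15; S5 §2.1 (K9) (p), proofs/P1-TWOMARK.md §4)

Under `Q₀ = {a₁ ↮ a₂}` the STATUS of a vertex is `1` (in `C₁`), `2` (in `C₂`) or `0` (outside `U`);
`cellIdx ω` encodes the pair of statuses of `o` and `b` as `3·s(o) + s(b) ∈ {1, …, 8}`, the cell
`(0, 0)` split into `9` (`o ↮ b`) and `10` (`o ↔ b`), and `0` off `Q₀`. `cellMass p k = P_p(cellIdx = k)`;
`prob_cellIdx_mem`: the probability of a union of cells is the sum of their masses. -/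

namespace Summit.Ventures.PercRepro2

namespace CaseOne

section Cells
variable {V : Type*} {E : Type*} [Fintype E] [DecidableEq E] {R : Type*} [CommRing R]

open Classical in
/-- The status of `v`: `1` in `C₁`, `2` in `C₂`, `0` otherwise (read under `Q₀`). -/
noncomputable def status (ends : E → Sym2 V) (ω : Config E) (a₁ a₂ v : V) : ℕ :=
  if Conn ends ω a₁ v then 1 else if Conn ends ω a₂ v then 2 else 0

open Classical in
/-- The status cell of `(o, b)`: `0` off `Q₀`; `3·s(o) + s(b)` when not both outside `U`; `10` / `9`
for both outside `U` and `o ↔ b` / `o ↮ b`. -/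
noncomputable def cellIdx (ends : E → Sym2 V) (ω : Config E) (o a₁ a₂ b : V) : ℕ :=
  if Conn ends ω a₁ a₂ then 0
  else if status ends ω a₁ a₂ o = 0 ∧ status ends ω a₁ a₂ b = 0 then (if Conn ends ω o b then 10 else 9)
  else 3 * status ends ω a₁ a₂ o + status ends ω a₁ a₂ b

/-- The mass of the cell `k`. -/
noncomputable def cellMass (p : E → R) (ends : E → Sym2 V) (o a₁ a₂ b : V) (k : ℕ) : R :=
  prob p {ω | cellIdx ends ω o a₁ a₂ b = k}

/-- **The probability of a union of cells is the sum of the cell masses.** -/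
theorem prob_cellIdx_mem (p : E → R) (ends : E → Sym2 V) (o a₁ a₂ b : V) (K : Finset ℕ) :
    prob p {ω | cellIdx ends ω o a₁ a₂ b ∈ K} = ∑ k ∈ K, cellMass p ends o a₁ a₂ b k := by
  unfold cellMass prob
  rw [Finset.sum_comm]
  refine Finset.sum_congr rfl fun ω _ => ?_
  by_cases hω : cellIdx ends ω o a₁ a₂ b ∈ K
  · rw [Set.indicator_of_mem (show ω ∈ {ω | cellIdx ends ω o a₁ a₂ b ∈ K} from hω)]
    rw [Finset.sum_eq_single (cellIdx ends ω o a₁ a₂ b)]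
    · rw [Set.indicator_of_mem (show ω ∈ {ω' | cellIdx ends ω' o a₁ a₂ b = cellIdx ends ω o a₁ a₂ b} from rfl)]
    · intro k _ hk
      exact Set.indicator_of_notMem (show ω ∉ {ω' | cellIdx ends ω' o a₁ a₂ b = k} from fun h => hk h.symm) _
    · intro h; exact absurd hω h
  · rw [Set.indicator_of_notMem (show ω ∉ {ω | cellIdx ends ω o a₁ a₂ b ∈ K} from hω)]
    symm
    refine Finset.sum_eq_zero fun k hk => ?_
    exact Set.indicator_of_notMem (show ω ∉ {ω' | cellIdx ends ω' o a₁ a₂ b = k} from fun h => hω (h ▸ hk)) _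

end Cells

end CaseOne

end Summit.Ventures.PercRepro2
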